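import Mathlib
import Summits.Ventures.PercRepro2.OneEdge
import Summits.Ventures.PercRepro2.KPrimeReduction
import Summits.Ventures.PercRepro2.KPrimeVYDict
import Summits.Ventures.PercRepro2.KPrimeLeakUGlue

/-!
# The E-slope potential does not see a direct edge `a₁–v`
(blind cell PercRepro2, mine-c g38; `conjectures/MINE-C.md` §47.6)

Let `e` be an edge with `ends e = s(a₁, v)` and `p e ≠ 1`.  In the world `p[e ↦ 1]` the
vertices `a₁` and `v` are identified, so on the configurations of the other edges
* `S = {a₂ ↮ {a₁, v}}` and `Y ∩ S` keep their `e`-closed masses (`prob_pin_one_S`,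
  `prob_pin_one_YS`),
* `U ∩ Ω = {a₁ ↔ v} ∩ {a₁ ↮ a₂}` and `U ∩ Y ∩ Ω` become `S` and `Y ∩ S`
  (`prob_pin_one_UΩ`, `prob_pin_one_UYΩ`),
* the class `(0,1)` and `N = {a₁ ↮ {a₂, v}}` vanish (`prob_pin_one_cls01`, `prob_pin_one_N`).
Hence `Num(p[e ↦ 1]) = 0` and, by the pinning identity `prob_eq_pin`,
`Num(p) = (1 − p e)·Num(p[e ↦ 0])` while `P_p(S)·P_p(N) = (1 − p e)·P⁰(S)·P⁰(N)`: the potential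
`F(p) = Num(p)/(P_p(S)·P_p(N))` of `KPrimeLeakUGlue.lean` (`slopeNum`) is INVARIANT under the
weight of a direct edge `a₁–v` (`potential_a1v_invariant`, the cleared form; `potential_a1v_eq`
the quotient form).  In particular «`z′` a leaf at `v`» is an equality locus of the unfrozen glue
for the trivial reason that gluing such a `z′` to `a₁` is adding an edge `a₁–v`.
-/

namespace Summit.Ventures.PercRepro2

namespace KPrime

variable {V : Type*} {E : Type*} [Fintype E] [DecidableEq E] [Fintype V] [DecidableEq V]
  {R : Type*} [Field R] [LinearOrder R] [IsStrictOrderedRing R]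

section Dictionary

variable {ends : E → Sym2 V} {a₁ a₂ v y : V} {e : E}

omit [Fintype E] [Fintype V] [Field R] [LinearOrder R] [IsStrictOrderedRing R] in
/-- Opening `e = {a₁, v}` on top of `ω` does not change `S = {a₂ ↮ {a₁, v}}`. -/
lemma mem_S_update_a1v (he : ends e = s(a₁, v)) (ω : Config E) :
    Function.update ω e true ∈ S ends a₁ a₂ v ↔ ω ∈ S ends a₁ a₂ v := by
  have h₁ : Conn ends ω a₁ a₁ := conn_refl ends ω a₁
  have h₂ : Conn ends ω v v := conn_refl ends ω v
  simp only [S, mem_avoidAll, Finset.mem_insert, Finset.mem_singleton, forall_eq_or_imp,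
    forall_eq]
  rw [OneEdge.conn_update_true_iff he, OneEdge.conn_update_true_iff he]
  tauto

omit [Fintype E] [Fintype V] [Field R] [LinearOrder R] [IsStrictOrderedRing R] in
/-- Opening `e = {a₁, v}` does not change `Y ∩ S`. -/
lemma mem_YS_update_a1v (he : ends e = s(a₁, v)) (ω : Config E) :
    Function.update ω e true ∈ connEvent ends a₂ y ∩ S ends a₁ a₂ v ↔
      ω ∈ connEvent ends a₂ y ∩ S ends a₁ a₂ v := by
  rw [Set.mem_inter_iff, Set.mem_inter_iff, mem_S_update_a1v he, mem_connEvent, mem_connEvent,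
    OneEdge.conn_update_true_iff he]
  simp only [S, mem_avoidAll, Finset.mem_insert, Finset.mem_singleton, forall_eq_or_imp,
    forall_eq]
  tauto

omit [Fintype E] [Fintype V] [Field R] [LinearOrder R] [IsStrictOrderedRing R] in
/-- With `e = {a₁, v}` open, `U ∩ Ω = {a₁ ↔ v} ∩ {a₁ ↮ a₂}` is the `e`-closed `S`. -/
lemma mem_UΩ_update_a1v (he : ends e = s(a₁, v)) (ω : Config E) :
    Function.update ω e true ∈ connEvent ends a₁ v ∩ Ω ends a₁ a₂ ↔ ω ∈ S ends a₁ a₂ v := by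
  have h₁ : Conn ends ω a₁ a₁ := conn_refl ends ω a₁
  have h₂ : Conn ends ω v v := conn_refl ends ω v
  have hs₁ : Conn ends ω a₁ a₂ ↔ Conn ends ω a₂ a₁ := ⟨conn_symm, conn_symm⟩
  have hs₂ : Conn ends ω v a₂ ↔ Conn ends ω a₂ v := ⟨conn_symm, conn_symm⟩
  simp only [S, Ω, Set.mem_inter_iff, mem_connEvent, mem_avoidAll, Finset.mem_insert,
    Finset.mem_singleton, forall_eq_or_imp, forall_eq]
  rw [OneEdge.conn_update_true_iff he, OneEdge.conn_update_true_iff he]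
  tauto

omit [Fintype E] [Fintype V] [Field R] [LinearOrder R] [IsStrictOrderedRing R] in
/-- With `e = {a₁, v}` open, `U ∩ Y ∩ Ω` is the `e`-closed `Y ∩ S`. -/
lemma mem_UYΩ_update_a1v (he : ends e = s(a₁, v)) (ω : Config E) :
    Function.update ω e true ∈ connEvent ends a₁ v ∩ connEvent ends a₂ y ∩ Ω ends a₁ a₂ ↔
      ω ∈ connEvent ends a₂ y ∩ S ends a₁ a₂ v := by
  have h₁ : Conn ends ω a₁ a₁ := conn_refl ends ω a₁
  have h₂ : Conn ends ω v v := conn_refl ends ω v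
  have hs₁ : Conn ends ω a₁ a₂ ↔ Conn ends ω a₂ a₁ := ⟨conn_symm, conn_symm⟩
  have hs₂ : Conn ends ω v a₂ ↔ Conn ends ω a₂ v := ⟨conn_symm, conn_symm⟩
  simp only [S, Ω, Set.mem_inter_iff, mem_connEvent, mem_avoidAll, Finset.mem_insert,
    Finset.mem_singleton, forall_eq_or_imp, forall_eq]
  rw [OneEdge.conn_update_true_iff he, OneEdge.conn_update_true_iff he,
    OneEdge.conn_update_true_iff he]
  tauto

omit [Fintype E] [Fintype V] [Field R] [LinearOrder R] [IsStrictOrderedRing R] in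
/-- With `e = {a₁, v}` open, the class `(0,1)` (which needs `a₁ ↮ v`) is empty. -/
lemma mem_cls01_update_a1v (he : ends e = s(a₁, v)) (ω : Config E) :
    Function.update ω e true ∈ cls01 ends a₁ a₂ v y ↔ ω ∈ (∅ : Set (Config E)) := by
  have h₁ : Conn ends ω a₁ a₁ := conn_refl ends ω a₁
  have h₂ : Conn ends ω v v := conn_refl ends ω v
  have hc : Function.update ω e true ∈ connEvent ends a₁ v :=
    (OneEdge.conn_update_true_iff he ω a₁ v).2 (Or.inr (Or.inl ⟨h₁, h₂⟩))
  constructor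
  · intro h
    exact (h.1.1 hc).elim
  · intro h
    exact h.elim

omit [Fintype E] [Fintype V] [Field R] [LinearOrder R] [IsStrictOrderedRing R] in
/-- With `e = {a₁, v}` open, `N = {a₁ ↮ {a₂, v}}` is empty. -/
lemma mem_N_update_a1v (he : ends e = s(a₁, v)) (ω : Config E) :
    Function.update ω e true ∈ N ends a₁ a₂ v ↔ ω ∈ (∅ : Set (Config E)) := by
  have h₁ : Conn ends ω a₁ a₁ := conn_refl ends ω a₁
  have h₂ : Conn ends ω v v := conn_refl ends ω v
  have hc : Conn ends (Function.update ω e true) a₁ v :=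
    (OneEdge.conn_update_true_iff he ω a₁ v).2 (Or.inr (Or.inl ⟨h₁, h₂⟩))
  constructor
  · intro h
    exact (h v (Finset.mem_insert_of_mem (Finset.mem_singleton_self v)) hc).elim
  · intro h
    exact h.elim

end Dictionary

section Masses

variable {ends : E → Sym2 V} {a₁ a₂ v y : V} {p : E → R} {e : E}

omit [Fintype V] [IsStrictOrderedRing R] in
/-- `P¹(S) = P⁰(S)` for `e = {a₁, v}`. -/
lemma prob_pin_one_S (he : ends e = s(a₁, v)) (hp : p e ≠ 1) :
    prob (Function.update p e 1) (S ends a₁ a₂ v) =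
      prob (Function.update p e 0) (S ends a₁ a₂ v) := by
  apply prob_update_one_eq_update_zero_of_iff hp
  intro ω _
  simpa only [Function.update_idem] using mem_S_update_a1v (a₂ := a₂) he (Function.update ω e false)

omit [Fintype V] [IsStrictOrderedRing R] in
/-- `P¹(Y ∩ S) = P⁰(Y ∩ S)` for `e = {a₁, v}`. -/
lemma prob_pin_one_YS (he : ends e = s(a₁, v)) (hp : p e ≠ 1) :
    prob (Function.update p e 1) (connEvent ends a₂ y ∩ S ends a₁ a₂ v) =
      prob (Function.update p e 0) (connEvent ends a₂ y ∩ S ends a₁ a₂ v) := by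
  apply prob_update_one_eq_update_zero_of_iff hp
  intro ω _
  simpa only [Function.update_idem] using
    mem_YS_update_a1v (a₂ := a₂) (y := y) he (Function.update ω e false)

omit [Fintype V] [IsStrictOrderedRing R] in
/-- `P¹(U ∩ Ω) = P⁰(S)` for `e = {a₁, v}`. -/
lemma prob_pin_one_UΩ (he : ends e = s(a₁, v)) (hp : p e ≠ 1) :
    prob (Function.update p e 1) (connEvent ends a₁ v ∩ Ω ends a₁ a₂) =
      prob (Function.update p e 0) (S ends a₁ a₂ v) := by
  apply prob_update_one_eq_update_zero_of_iff hp
  intro ω _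
  simpa only [Function.update_idem] using mem_UΩ_update_a1v (a₂ := a₂) he (Function.update ω e false)

omit [Fintype V] [IsStrictOrderedRing R] in
/-- `P¹(U ∩ Y ∩ Ω) = P⁰(Y ∩ S)` for `e = {a₁, v}`. -/
lemma prob_pin_one_UYΩ (he : ends e = s(a₁, v)) (hp : p e ≠ 1) :
    prob (Function.update p e 1) (connEvent ends a₁ v ∩ connEvent ends a₂ y ∩ Ω ends a₁ a₂) =
      prob (Function.update p e 0) (connEvent ends a₂ y ∩ S ends a₁ a₂ v) := by
  apply prob_update_one_eq_update_zero_of_iff hp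
  intro ω _
  simpa only [Function.update_idem] using
    mem_UYΩ_update_a1v (a₂ := a₂) (y := y) he (Function.update ω e false)

omit [Fintype V] [IsStrictOrderedRing R] in
/-- `P¹((0,1)) = 0` for `e = {a₁, v}`. -/
lemma prob_pin_one_cls01 (he : ends e = s(a₁, v)) (hp : p e ≠ 1) :
    prob (Function.update p e 1) (cls01 ends a₁ a₂ v y) = 0 := by
  rw [prob_update_one_eq_update_zero_of_iff hp (B := (∅ : Set (Config E))), prob_empty]
  intro ω _
  simpa only [Function.update_idem] using
    mem_cls01_update_a1v (a₂ := a₂) (y := y) he (Function.update ω e false)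

omit [Fintype V] [IsStrictOrderedRing R] in
/-- `P¹(N) = 0` for `e = {a₁, v}`. -/
lemma prob_pin_one_N (he : ends e = s(a₁, v)) (hp : p e ≠ 1) :
    prob (Function.update p e 1) (N ends a₁ a₂ v) = 0 := by
  rw [prob_update_one_eq_update_zero_of_iff hp (B := (∅ : Set (Config E))), prob_empty]
  intro ω _
  simpa only [Function.update_idem] using mem_N_update_a1v (a₂ := a₂) he (Function.update ω e false)

end Masses

section Invariance

variable (ends : E → Sym2 V) (a₁ a₂ v y : V) (p : E → R) (e : E)

omit [Fintype V] [IsStrictOrderedRing R] in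
/-- `Num(p) = (1 − p e)·Num(p[e ↦ 0])` for `e = {a₁, v}`: `Num(p[e ↦ 1]) = 0`. -/
theorem slopeNum_pin_a1v (he : ends e = s(a₁, v)) (hp : p e ≠ 1) :
    slopeNum ends a₁ a₂ v y p = (1 - p e) * slopeNum ends a₁ a₂ v y (Function.update p e 0) := by
  have hS := prob_eq_pin p (S ends a₁ a₂ v) e
  have hYS := prob_eq_pin p (connEvent ends a₂ y ∩ S ends a₁ a₂ v) e
  have hUΩ := prob_eq_pin p (connEvent ends a₁ v ∩ Ω ends a₁ a₂) e
  have hc := prob_eq_pin p (cls01 ends a₁ a₂ v y) e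
  have hUYΩ := prob_eq_pin p (connEvent ends a₁ v ∩ connEvent ends a₂ y ∩ Ω ends a₁ a₂) e
  rw [prob_pin_one_S he hp] at hS
  rw [prob_pin_one_YS he hp] at hYS
  rw [prob_pin_one_UΩ he hp] at hUΩ
  rw [prob_pin_one_cls01 he hp] at hc
  rw [prob_pin_one_UYΩ he hp] at hUYΩ
  unfold slopeNum
  rw [hS, hYS, hUΩ, hc, hUYΩ]
  ring

omit [Fintype V] [IsStrictOrderedRing R] in
/-- `P_p(S)·P_p(N) = (1 − p e)·P⁰(S)·P⁰(N)` for `e = {a₁, v}`. -/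
theorem prob_S_mul_N_pin_a1v (he : ends e = s(a₁, v)) (hp : p e ≠ 1) :
    prob p (S ends a₁ a₂ v) * prob p (N ends a₁ a₂ v) =
      (1 - p e) * (prob (Function.update p e 0) (S ends a₁ a₂ v) *
        prob (Function.update p e 0) (N ends a₁ a₂ v)) := by
  have hS := prob_eq_pin p (S ends a₁ a₂ v) e
  have hN := prob_eq_pin p (N ends a₁ a₂ v) e
  rw [prob_pin_one_S he hp] at hS
  rw [prob_pin_one_N he hp] at hN
  rw [hS, hN]
  ring

omit [Fintype V] [IsStrictOrderedRing R] in
/-- **The potential does not see a direct edge `a₁–v`** (cleared form):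
`Num(p)·P⁰(S)·P⁰(N) = Num(p⁰)·P_p(S)·P_p(N)` with `p⁰ = p[e ↦ 0]`, `ends e = s(a₁, v)`. -/
theorem potential_a1v_invariant (he : ends e = s(a₁, v)) (hp : p e ≠ 1) :
    slopeNum ends a₁ a₂ v y p *
        (prob (Function.update p e 0) (S ends a₁ a₂ v) *
          prob (Function.update p e 0) (N ends a₁ a₂ v)) =
      slopeNum ends a₁ a₂ v y (Function.update p e 0) *
        (prob p (S ends a₁ a₂ v) * prob p (N ends a₁ a₂ v)) := by
  rw [slopeNum_pin_a1v ends a₁ a₂ v y p e he hp, prob_S_mul_N_pin_a1v ends a₁ a₂ v p e he hp]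
  ring

omit [Fintype V] [IsStrictOrderedRing R] in
/-- **The potential does not see a direct edge `a₁–v`** (quotient form): for `p e < 1`,
`F(p) = F(p[e ↦ 0])` where `F(q) = Num(q)/(P_q(S)·P_q(N))`. -/
theorem potential_a1v_eq (he : ends e = s(a₁, v)) (hp : p e < 1) :
    slopeNum ends a₁ a₂ v y p / (prob p (S ends a₁ a₂ v) * prob p (N ends a₁ a₂ v)) =
      slopeNum ends a₁ a₂ v y (Function.update p e 0) /
        (prob (Function.update p e 0) (S ends a₁ a₂ v) *
          prob (Function.update p e 0) (N ends a₁ a₂ v)) := by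
  have hp' : p e ≠ 1 := ne_of_lt hp
  have h1 : (1 - p e) ≠ 0 := sub_ne_zero.2 (Ne.symm hp')
  rw [slopeNum_pin_a1v ends a₁ a₂ v y p e he hp', prob_S_mul_N_pin_a1v ends a₁ a₂ v p e he hp',
    mul_div_mul_left _ _ h1]

end Invariance

end KPrime

end Summit.Ventures.PercRepro2
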